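import Mathlib
import Summits.Ventures.PercRepro2.HCov
import Summits.Ventures.PercRepro2.Graph
import Summits.Ventures.PercRepro2.RestrictClosure
import Summits.Ventures.PercRepro2.RECMReduction
import Summits.Ventures.PercRepro2.CutVertexPaths
import Summits.Ventures.PercRepro2.GcSkelRules
import Summits.Ventures.PercRepro2.GcSkelReduction
import Summits.Ventures.PercRepro2.GcSkelReductionI
import Summits.Ventures.PercRepro2.GcSkelTwoConnected

/-!
# The core of a (G1) instance is two-connected (blind cell PercRepro2, typer-1 g53)

On a (G1) instance of the residual — `WRed.WReducedI` with `a₃` a leaf — the graph `G − a₃` is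
two-connected on its non-isolated vertices: for every vertex `w`, two non-isolated vertices `x, y`
other than `w` and `a₃` are connected in `G − {w, a₃}` (**`conn_sepConfig_pair_of_g1`**). Proof:
`conn_sepConfig_of_wredI` joins them in `G − w`; a walk of `G − w` can only visit the leaf `a₃`
through its single edge, so the component of `x` in `G − {w, a₃}`, with `a₃` added when the leaf's
attachment is in it, is closed under open adjacency in `G − w` (`mem_of_conn_of_closed`).
So a (G1) instance is a pendant `a₃` on a two-connected core carrying `o, a₁, a₂, b`.
-/

namespace Summit.Ventures.PercRepro2

open CovForm RECM CutVertexM9 SepPair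

namespace WRed

section Core

variable {V : Type*} {E : Type*} [Fintype E] [DecidableEq V]
variable {ends : E → Sym2 V} {o a₁ a₂ a₃ b : V}

omit [Fintype E] [DecidableEq V] in
/-- A vertex reached from `x ∉ A` in `G − A` is not in `A`. -/
lemma not_mem_of_mem_cluster_sepConfig {A : Set V} {x z : V} (hx : x ∉ A)
    (hz : z ∈ cluster ends (sepConfig ends A) x) : z ∉ A :=
  not_mem_of_conn_sepConfig hx hz

omit [Fintype E] [DecidableEq V] in
/-- An edge open in `G − w` whose ends avoid `a₃` is open in `G − {w, a₃}`. -/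
lemma sepConfig_pair_eq_true {w : V} {e : E} {z u : V} (hends : ends e = s(z, u))
    (he : sepConfig ends {w} e = true) (hz : z ≠ a₃) (hu : u ≠ a₃) :
    sepConfig ends {w, a₃} e = true := by
  apply sepConfig_eq_true
  have hw := not_mem_of_not_mem_touches hends (not_mem_touches_of_sepConfig he)
  apply not_mem_touches_of_ends hends
  · simp only [Set.mem_insert_iff, Set.mem_singleton_iff, not_or]
    exact ⟨fun h => hw.1 (Set.mem_singleton_iff.2 h), hz⟩
  · simp only [Set.mem_insert_iff, Set.mem_singleton_iff, not_or]
    exact ⟨fun h => hw.2 (Set.mem_singleton_iff.2 h), hu⟩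

/-- **The core of a (G1) instance is two-connected**: on `WReducedI` with `a₃` a leaf, for every
vertex `w`, two non-isolated vertices other than `w` and `a₃` are connected in `G − {w, a₃}`. -/
theorem conn_sepConfig_pair_of_g1 (h : WReducedI ends o a₁ a₂ a₃ b) (hd3 : nonLoopDeg ends a₃ = 1)
    (h12 : a₁ ≠ a₂) (h13 : a₁ ≠ a₃) (h23 : a₂ ≠ a₃) (ho1 : o ≠ a₁) (ho2 : o ≠ a₂) (ho3 : o ≠ a₃)
    (hob : o ≠ b) (hb1 : b ≠ a₁) (hb2 : b ≠ a₂) (hb3 : b ≠ a₃) {w x y : V} (hxw : x ≠ w)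
    (hyw : y ≠ w) (hx3 : x ≠ a₃) (hy3 : y ≠ a₃) (hx : ∃ e, x ∈ ends e ∧ ¬ (ends e).IsDiag)
    (hy : ∃ e, y ∈ ends e ∧ ¬ (ends e).IsDiag) : Conn ends (sepConfig ends {w, a₃}) x y := by
  -- the leaf edge `e₀ = {v₀, a₃}`
  obtain ⟨e₀, v₀, he₀, hv₀, hleaf⟩ := leaf_of_nonLoopDeg_one hd3
  -- `x` and `y` are joined in `G − w`
  have hconn := conn_sepConfig_of_wredI h h12 h13 h23 ho1 ho2 ho3 hob hb1 hb2 hb3 hxw hyw hx3 hy3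
    hx hy
  -- the closed set: the component of `x` in `G − {w, a₃}`, plus `a₃` if `v₀` is in it
  set K := cluster ends (sepConfig ends {w, a₃}) x with hK
  have hxA : x ∉ ({w, a₃} : Set V) := by
    simp only [Set.mem_insert_iff, Set.mem_singleton_iff, not_or]
    exact ⟨hxw, hx3⟩
  have hK3 : a₃ ∉ K := fun h3 => not_mem_of_mem_cluster_sepConfig hxA h3 (by simp)
  -- the only non-loop edge at `a₃` is `e₀`
  have hedge : ∀ e, a₃ ∈ ends e → ¬ (ends e).IsDiag → e = e₀ := by
    intro e he hd
    by_contra hne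
    exact hd (hleaf e hne he)
  have hclosed : ∀ z ∈ {t | t ∈ K ∨ (t = a₃ ∧ v₀ ∈ K)}, ∀ u,
      (openGraph ends (sepConfig ends {w})).Adj z u → u ∈ {t | t ∈ K ∨ (t = a₃ ∧ v₀ ∈ K)} := by
    intro z hz u hadj
    rw [openGraph_adj] at hadj
    obtain ⟨hzu, e, he, hends⟩ := hadj
    have hze : z ∈ ends e := by rw [hends]; exact Sym2.mem_mk_left _ _
    have hue : u ∈ ends e := by rw [hends]; exact Sym2.mem_mk_right _ _
    have hed : ¬ (ends e).IsDiag := by rw [hends, Sym2.mk_isDiag_iff]; exact hzu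
    simp only [Set.mem_setOf_eq] at hz ⊢
    rcases hz with hzK | ⟨rfl, hv₀K⟩
    · -- `z` in the component: `u` is `a₃` (then `z = v₀`) or joins the component
      by_cases hu3 : u = a₃
      · subst hu3
        have hee : e = e₀ := hedge e hue hed
        subst hee
        have hz' : z = v₀ := by
          rw [he₀, Sym2.eq_iff] at hends
          rcases hends with ⟨h1, -⟩ | ⟨-, h2⟩
          · exact h1.symm
          · exact absurd h2.symm hzu
        exact Or.inr ⟨rfl, hz' ▸ hzK⟩
      · left
        have hz3 : z ≠ a₃ := fun h' => hK3 (h' ▸ hzK)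
        exact mem_cluster_of_adj hzK
          (openGraph_adj.2 ⟨hzu, e, sepConfig_pair_eq_true hends he hz3 hu3, hends⟩)
    · -- `z = a₃`: its only edge leads back to `v₀ ∈ K`
      have hee : e = e₀ := hedge e hze hed
      subst hee
      have hu' : u = v₀ := by
        rw [he₀, Sym2.eq_iff] at hends
        rcases hends with ⟨h1, -⟩ | ⟨h1, -⟩
        · exact absurd h1 hv₀
        · exact h1.symm
      exact Or.inl (hu' ▸ hv₀K)
  have hy' := mem_of_conn_of_closed hclosed (Or.inl (mem_cluster_self _ _ _)) hconn
  simp only [Set.mem_setOf_eq] at hy'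
  rcases hy' with hyK | ⟨hy3', -⟩
  · exact hyK
  · exact absurd hy3' hy3

end Core

end WRed

end Summit.Ventures.PercRepro2
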